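import Summits.HodgeConjecture.HodgeConjecture.Theses.BiquadraticSecantLift
import Summits.HodgeConjecture.HodgeConjecture.Theorems.WeilTypeLadderVariationalLocal
import Summits.HodgeConjecture.HodgeConjecture.Theorems.HeckePrymWeilHyperbolicEightfoldsSqrtMinus7OfAnchorObject
import Literature.AlgebraicGeometry.HodgeTheory.WeilClassesCMReductionPolarized
import Literature.AlgebraicGeometry.HodgeTheory.WeilClassesFieldOneClass
import Literature.AlgebraicGeometry.HodgeTheory.WeilClassesFieldIsogenyInvariance
import Literature.AlgebraicGeometry.HodgeTheory.WeilClassesBlochSeed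
import Literature.AlgebraicGeometry.HodgeTheory.BlochSemiregularSpread
import Literature.AlgebraicGeometry.HodgeTheory.LefschetzOneOneHolds
import Literature.AlgebraicGeometry.HodgeTheory.IsoTransport
import Literature.AlgebraicGeometry.HodgeTheory.WeilClassesCyclicPrymDegreeTwelve
import Literature.AlgebraicGeometry.HodgeTheory.WeilFamilyReachCMField
import Summits.HodgeConjecture.HodgeConjecture.Theorems.MarkmanBiquadraticTwelvefoldsSeedReach
import HarnessLib
import HarnessLib.Audit

/-!
# Line `prymseedpol` — the line of record `prymseed` RE-CUT OVER THE POLARIZED CRUX X1pol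
# `MarkmanBiquadraticTwelvefoldsPolarized` (route-HodgeConjecture-BiquadraticSecantLift rev 2, retarget R13.3(2), 2026-08-28)

Fourth workfile on the crux directory `Cruxes/MarkmanBiquadraticTwelvefolds/` (after `Lines/birth.lean`, `Lines/seed.lean`,
`Lines/prym.lean`, `Lines/prymseed.lean` = the registered line of record on X1, sha a998bbb9487e). It is REGISTERED ON THE NEW
CRUX ITEM X1pol (`ledger skeleton check … --crux <X1pol item>`); it lives in the old crux's directory because that is where this
seat may write. Nothing here proves the Hodge conjecture, rung H2 `SevenfoldWeilCensus.WeilSixfolds`, X1, X1pol, the rung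
`X1polAt 1 3` or `PrymSeed13`: the load-bearing statements are `sorry` stubs.

## What changed relative to `Lines/prymseed.lean` (and why)

THE RETARGET (director-hodge R13.3(2); memo `RETARGET-X1pol.md` 579786377348; x2-p1 g7/g8 findings p606539/p606540/p608780,
memo `POSITIVITY-LEMMA-x2p1-g8.md`): X1 as typed quantified over CLASS-LEVEL hyperbolic targets (`IsHyperbolicWeilTypeCM`: a
polarization CLASS, no positivity), but Deligne's family `Γ\X⁺` (Thm. 4.8 (a)+(b)) — hence the REACH step of every seed line —
only reaches GENUINELY POLARIZED targets (`IsPolarizedHyperbolicWeilTypeCM`: a real multiple of the class is KÄHLER); the gap is a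
class-field-theoretic positivity lemma on `NS` of special members that no engine needs and the print never states. Route rev 2
therefore replaces the binder X1 by the WEAKER X1pol (polarized targets; `X1 → X1pol`, `x1polAll_of_x1` below) and the closed X2 by the
STRONGER X2pol `BiquadraticBaseChangePolarized` (the base change `(A ⊞ A, η_(d,m))` IS polarized — PROVED, p608780), with the same
six-line `closes`. On this line the effect is exactly one stub:

* §0 `X1polAt d m` — the crux body at fixed `(d, m)` with POLARIZED hypothesis (was `X1polAt`).
* §2 `SeedReachPolAt d m` / `SeedReachPol` — REACH with POLARIZED targets (was `SeedReachPolAt` / `SeedReachPol`, class-level targets):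
  VERBATIM the conclusion of the LANDED helper `BiquadraticSecantLift.seedReachAt_polarized_of_weilFamilyReachCM` (p606540), so
  REACH IS NO LONGER A STUB: `seedReachPol_of_fact : deligne1982_weilFamilyReachCM_polarizedSplit → SeedReachPol` (proved, §3).
* §3 stubs (FOUR, as before; names kept where the statement is unchanged): `stub_seedAnchor : SeedAnchors` (UNCHANGED — hardest,
  the object-level seed; its members were already polarized), `stub_reachFact : HodgeTheory.deligne1982_weilFamilyReachCM_polarizedSplit`
  (NEW in place of `stub_seedReach`: the NAMED LITERATURE FACT — Deligne 1982 proof of Thm. 4.8 / Lemma 4.6 / §5 for a CM FIELD, typed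
  and accepted as `Literature/AlgebraicGeometry/HodgeTheory/WeilFamilyReachCMField.lean` (p606539) — carried as formalisation debt
  exactly as `Cruxes/NonsplitSixfoldCells/Lines/birth.lean: stub_reach : weilFamilyReach_hyperbolic` carries its `K`-analogue),
  `stub_rung_d1_m3 : X1polAt 1 3` (same NAME, the T3 plan-only rung now in its polarized spelling), `stub_prymSeed13 : PrymSeed13`
  (UNCHANGED — the lever at the refereed `ℤ/12`-Prym anchor; its seed body was already polarized).
* §4 `x1polAt_of_seed : SeedAnchorAt d m → SeedReachPolAt d m → X1polAt d m` — the amplification, proof VERBATIM (the target's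
  `IsWeilTypeCM` comes from `.isWeilTypeCM` of the polarized datum); `MarkmanBiquadraticTwelvefoldsPolarized_of_stubs` concludes
  the NEW crux BY NAME from `stub_seedAnchor` and `stub_reachFact` alone.
* §5 unchanged, plus `rung_d1_m3_of_prymSeed_of_fact : PrymSeed13 → deligne1982_weilFamilyReachCM_polarizedSplit → X1polAt 1 3`:
  the rung's plan is now LEVER AT THE ANCHOR + THE NAMED FACT (no REACH stub).

Class test of record (w-1 g8, `CLASS-TEST-prym.md` 2db1731a44a8): verdict PRYM-SEED-NONE for entrance (i) — at a very general
`ℤ/12`-Prym member the generic Hodge ring is `⟨h_K, W_L⟩`, so a curve-remembering cycle cannot be semiregular on the 18-dimensional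
family; live residue = Markman's Question 12.2.2 / a `B`-secant object on the dihedral RM sixfold factor (entrance (iii)). The
retarget does not touch this: seeds were always sought among POLARIZED members.

## The line (unchanged idea; see `Lines/prymseed.md` / `Lines/seed.md`)

SEED (one seeded polarized hyperbolic member `(P, η_P, h, w)` of each split biquadratic `(L,6)`-component, `LocalClauseAt P h w`:
`q·H³ + W` algebraic on a Euclidean neighbourhood of the seed point in EVERY smooth projective family carrying `h`, `w` as global
fibrewise-Hodge classes) ∧ REACH (Deligne's polarized family through the seed reaches every POLARIZED hyperbolic target up to an
`L`-equivariant isogeny, with the flat non-zero Weil class — NOW A THEOREM modulo the named fact) ⟹ X1pol, by §4: open algebraic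
locus ⟹ every fibre algebraic (algebraicity locus = countable union of closed algebraic subsets, one with interior; tree theorem
`WeilTypeLadder.mem_algebraicClasses_of_isOpen_subset_algebraicityLocus`) ⟹ `W_{s₁}` algebraic (Lefschetz (1,1) + cup products on
the abelian fibre remove `q·H³`) ⟹ its transport along the chart and the isogeny is a non-zero rational algebraic `L`-Weil class on
the target ⟹ the whole `L`-Weil space of the target is algebraic (one-class lemma `weilClassesField_le_algebraicClasses_of_…`).
§5: the seed AT the genus-`4` `ℤ/12`-Prym anchor of the `(1,3)` cell (`L = ℚ(ζ₁₂)`), where Schoen's refereed theorem makes every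
`L`-Weil class algebraic (`prym_basepoint`: the base-point requirement of the local clause holds there for all candidate data).

WHY IT MIGHT FAIL (unchanged): (a) no semiregular / flat codimension-3 object is known on any abelian 12-fold of these families
(Markman postpones `[K:ℚ] = 4` in print, RM paper §1.1 last paragraph; survey Q 12.2.2); (b) rigidity: curve-remembering cycles at
the Prym anchor are not semiregular on the 18-dimensional family (class test); (c) the named fact is typed, not proved (size M–L on
the carriers: universal abelian scheme over a neat level cover of `Γ\X⁺`, theorem of the fixed part for `W`).

## References
[cite: Deligne1982HodgeCycles, §4 Cor. 4.2, Prop. 4.4, Lemma 4.6, Thm. 4.8 (a)(b) and its proof (pp. 32–34), §5]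
[cite: Milne2020HodgeClassesAV, §2 2.1] [cite: Schoen1988HodgeWeil, Thm. 2.0 (p. 11), Cor. 3.1 (p. 24), pp. 25–26]
[cite: PatelZhang2025PrymHodge, Lemma 5.1, §5.1, Thm. 5.3] [cite: Markman2025SecantRealMultiplication, §1.1, Prop. 1.1.1, Thm. 1.1.2]
[cite: Markman2025SurveySecant, §4, Question 12.2.2] [cite: Markman2025SecantWeil, Thm. 1.5.1, §1.5] [cite: Bloch1972Semiregularity, Thm. (7.4), Remark (7.5)]
[cite: BuchweitzFlenner2003, Thm. 5.1, Thm. 5.2] [cite: CharlesSchnell2014Notes, Prop. 11.3.11] [cite: vanGeemen1994HodgeAV, 5.2, 5.4, 7.1]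
[cite: MoonenZarhin1998WeilClasses, §1] [cite: Landherr1936HermitianForms]
-/

noncomputable section

-- single-problem summit (Problem = Summit): the mandated namespace repeats `HodgeConjecture`.
set_option linter.dupNamespace false

open CategoryTheory CategoryTheory.Limits AlgebraicGeometry
open Literature.AlgebraicGeometry Literature.AlgebraicGeometry.Motives Literature.AlgebraicGeometry.HodgeTheory
open Literature.AlgebraicGeometry.Deligne1982
open Literature.AlgebraicTopology.SingularHomology
open Literature.AlgebraicGeometry.VanGeemen1994 (pullbackOne)
open Summit.HodgeConjecture.HodgeConjecture.WeilTypeLadder (mem_algebraicClasses_of_isOpen_subset_algebraicityLocus)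
open Summit.HodgeConjecture.HodgeConjecture.Theorems.HyperbolicEightfoldsSqrtMinus7.AnchorObject
  (cupPowTwo_mem_algebraicClasses_abelian)

namespace Summit.HodgeConjecture.HodgeConjecture.Cruxes.MarkmanBiquadraticTwelvefolds.PrymSeedPol


/-! ## §0 Vocabulary (verbatim from `Lines/birth.lean`: the route's polynomial and the crux body at fixed `(d, m)`) -/

/-- `R_(d,m)(S) = S² + 2d(1+m)·S + d²(m-1)²` — LITERALLY the route's polynomial (`E = L = ℚ[T]/(R_(d,m)(T²)) = ℚ(√-d, √m)`). -/
def bqPoly (d m : ℕ) : Polynomial ℤ :=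
  Polynomial.X ^ 2 + Polynomial.C (2 * (d : ℤ) * (1 + (m : ℤ))) * Polynomial.X +
    Polynomial.C ((d : ℤ) ^ 2 * ((m : ℤ) - 1) ^ 2)

/-- **X1pol at fixed `(d, m)`** — the POLARIZED crux's body with `R_(d,m) = bqPoly d m`: targets carry a genuine split
`L`-compatible polarization (`IsPolarizedHyperbolicWeilTypeCM`: a non-zero real multiple of the class is Kähler). The RUNG
`X1polAt 1 3` is its `(1,3)` instance. (`Lines/prymseed.lean`'s `X1At` had the class-level hypothesis `IsHyperbolicWeilTypeCM`;
`X1At d m → X1polAt d m` by `IsPolarizedHyperbolicWeilTypeCM.isHyperbolicWeilTypeCM`.) -/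
def X1polAt (d m : ℕ) : Prop :=
  ∀ (B : AbelianVariety ℂ) (η : B ⟶ B), IsPolarizedHyperbolicWeilTypeCM B η (bqPoly d m) 2 3 →
    ∀ c ∈ weilClassesField B η ((bqPoly d m).comp (Polynomial.X ^ 2)) 6,
      IsRationalClass c → IsOfHodgeType B.dim B.X 6 3 3 c → c ∈ algebraicClasses B.X 3

/-! ## §1 The local clause at a member, and its lci (Bloch) entrance -/

/-- **LOCAL CLAUSE at a member `P` for the class data `(h, w)`** (mechanism-agnostic; the shape of the tree's
`WeilAnchorLocalClause` without its unused abelian-fibre clause, in relative dimension `12`, codimension `3`): along every smooth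
projective family `f : 𝒳 ⟶ S` of relative dimension `12` with quasi-projective total space over a smooth irreducible
quasi-projective base, for all global classes `H ∈ H²(𝒳)` (fibrewise rational `(1,1)`) and `W ∈ H⁶(𝒳)` (fibrewise rational
`(3,3)`) and every chart `e' : P ≅ 𝒳_{s₀}` with `e'^*H_{s₀} = h`, `e'^*W_{s₀} = w`, there are a Euclidean-open `U ∋ s₀` and `q ∈ ℚ`
with `q·H_s³ + W_s` ALGEBRAIC on `𝒳_s` for all `s ∈ U`. Outputs of: Bloch's theorem for an lci semiregular seed
(`localClauseAt_of_blochSpread_of_blochSeed`), Buchweitz–Flenner Thm. 5.1 for a semiregular SHEAF with `ch₃ = q·h³ + w`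
(Markman's secant sheaf), the pro-representability criterion BF Thm. 4.9. PREDICATE, nothing asserted.
[cite: Bloch1972Semiregularity, Thm. (7.4)] [cite: BuchweitzFlenner2003, Thm. 5.1 and Thm. 5.2] [cite: Markman2025SecantWeil, §1.5] -/
def LocalClauseAt (P : AbelianVariety ℂ) (h : complexBetti P.X 2) (w : complexBetti P.X (2 * 3)) : Prop :=
  ∀ ⦃𝒳 S : SchemeOver ℂ⦄ (f : 𝒳 ⟶ S), IsSmoothProjectiveFamily f (2 * 3 * 2) →
    IsQuasiProjectiveOver 𝒳 → IsQuasiProjectiveOver S → IrreducibleSpace S.left → AlgebraicGeometry.Smooth S.hom →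
    ∀ (H : complexBetti 𝒳 2) (W : complexBetti 𝒳 (2 * 3)),
      (∀ s : ComplexPoints S, IsRationalClass (complexBetti.map (fiberι f s) 2 H) ∧
          IsOfHodgeType (2 * 3 * 2) (fiberOver f s) 2 1 1 (complexBetti.map (fiberι f s) 2 H)) →
      (∀ s : ComplexPoints S, IsRationalClass (complexBetti.map (fiberι f s) (2 * 3) W) ∧
          IsOfHodgeType (2 * 3 * 2) (fiberOver f s) (2 * 3) 3 3 (complexBetti.map (fiberι f s) (2 * 3) W)) →
      ∀ (s₀ : ComplexPoints S) (e' : P.X ≅ fiberOver f s₀),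
        complexBetti.map e'.hom 2 (complexBetti.map (fiberι f s₀) 2 H) = h →
        complexBetti.map e'.hom (2 * 3) (complexBetti.map (fiberι f s₀) (2 * 3) W) = w →
        ∃ (U : Set (ComplexPoints S)) (q : ℚ), IsOpen U ∧ s₀ ∈ U ∧
          ∀ s ∈ U, ((q : ℚ) : ℂ) • cupPowTwo (complexBetti.map (fiberι f s) 2 H) 3 +
            complexBetti.map (fiberι f s) (2 * 3) W ∈ algebraicClasses (fiberOver f s) 3

/-- **A Bloch seed for `q·h³ + w` on the twelvefold `P`** (the tree's `HasBlochSeedAt` with the ambient read as a `12`-fold and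
codimension `3` — `HasBlochSeedAt n` hard-codes codimension `n` in a `2n`-fold): an INTEGRAL local complete intersection
`i : Z ↪ P` of codimension `3`, Bloch-semiregular (`IsBlochSemiregular i 12 3`), with `q·h³ + w` supported on `Z`. PREDICATE.
[cite: Bloch1972Semiregularity, Thm. (7.4) and Remark (7.5)] [cite: BuchweitzFlenner2003, Thm. 5.2 and (8.1)] -/
def HasBlochSeedAt12 (P : AbelianVariety ℂ) (h : complexBetti P.X 2) (w : complexBetti P.X (2 * 3)) : Prop :=
  ∃ (Z : Scheme.{0}) (i : Z ⟶ P.X.left) (q : ℚ),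
    IsClosedImmersion i ∧ IsRegularImmersionOfCodim i 3 ∧ AlgebraicGeometry.IsIntegral Z ∧
    (∀ z ∈ Set.range i.base, ((3 : ℕ) : ℕ∞) ≤ Order.coheight z) ∧
    IsBlochSemiregular i (2 * 3 * 2) 3 ∧
    ((q : ℚ) : ℂ) • cupPowTwo h 3 + w ∈ classesSupportedOn P.X (Set.range i.base) (2 * 3)

/-- **BRIDGE (proved): Bloch's theorem (class level, REFEREED fact `BlochSemiregularSpread 12 3`) ∧ a Bloch seed ⟹ the local
clause.** Verbatim transposition of the tree's `weilAnchorLocalClause_of_blochSpread_of_blochSeedAt` to `(12, 3)`.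
[cite: Bloch1972Semiregularity, Thm. (7.4)] [cite: BuchweitzFlenner2003, Thm. 5.2] [cite: VoisinTorino1994, Lecture 7, Thm. 2.4] -/
theorem localClauseAt_of_blochSpread_of_blochSeed (hB : BlochSemiregularSpread (2 * 3 * 2) 3)
    {P : AbelianVariety ℂ} {h : complexBetti P.X 2} {w : complexBetti P.X (2 * 3)} (hS : HasBlochSeedAt12 P h w) :
    LocalClauseAt P h w := by
  obtain ⟨Z, i, q, hi, hreg, hint, hcoh, hsr, hsupp⟩ := hS
  intro 𝒳 S f hf h𝒳qp hSqp _ hsm H W hH hW s₀ e' hH₀ hW₀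
  set B : complexBetti 𝒳 (2 * 3) := ((q : ℚ) : ℂ) • cupPowTwo H 3 + W with hBdef
  have hres : ∀ s : ComplexPoints S, complexBetti.map (fiberι f s) (2 * 3) B =
      ((q : ℚ) : ℂ) • cupPowTwo (complexBetti.map (fiberι f s) 2 H) 3 + complexBetti.map (fiberι f s) (2 * 3) W := by
    intro s
    rw [hBdef, map_add, map_smul, complexBetti_map_cupPowTwo']
  have hBrat : ∀ s : ComplexPoints S,
      IsRationalClass (complexBetti.map (fiberι f s) (2 * 3) B) ∧
        IsOfHodgeType (2 * 3 * 2) (fiberOver f s) (2 * 3) 3 3 (complexBetti.map (fiberι f s) (2 * 3) B) := by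
    intro s
    rw [hres]
    exact ⟨(((hH s).1.cupPowTwo 3).smul q).add (hW s).1,
      ((isOfHodgeType_cupPowTwo (hf.isSmoothProjective s) (hH s).2 3).smul _).add (hf.isSmoothProjective s) (hW s).2⟩
  have hx : complexBetti.map e'.hom (2 * 3) (complexBetti.map (fiberι f s₀) (2 * 3) B) =
      ((q : ℚ) : ℂ) • cupPowTwo h 3 + w := by
    rw [hres, map_add, map_smul, complexBetti_map_cupPowTwo', hH₀, hW₀]
  obtain ⟨U, hUo, hs₀U, hU⟩ :=
    hB P.X Z i (((q : ℚ) : ℂ) • cupPowTwo h 3 + w) 𝒳 S f s₀ e' B hi hreg hint hcoh hsr hsupp hf h𝒳qp hSqp hsm hBrat hx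
  refine ⟨U, q, hUo, hs₀U, fun s hs => ?_⟩
  rw [← hres]
  exact hU s hs

/-! ## §2 The two stubs' statements at fixed `(d, m)`: SEED (object-level anchor) and REACH (Deligne's family, up to isogeny) -/

/-- **SEED at `(d, m)`** — a SEEDED POLARIZED HYPERBOLIC MEMBER of the split `(L,6)`-component: `(P, η_P)` of Weil type for
`L = ℚ[T]/(R_(d,m)(T²))` of `L`-rank `6` (`IsWeilTypeCM P η_P R 2 3`) with a class `h` which is a polarization class some real
multiple of which is KÄHLER (Deligne Thm. 4.8: a genuine polarization), whose Rosati involution is complex conjugation on `L`,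
of SPLIT discriminant and with an `η_P^*`-stable rational Lagrangian (Cor. 4.2 (a)(b)) — the binders of the tree's
`IsPolarizedHyperbolicWeilTypeCM`, unbundled to name `h` —, a NON-ZERO RATIONAL `L`-Weil class `w ∈ W_L(P) ⊗ ℂ`, and the LOCAL
CLAUSE for `(h, w)`. Candidate: Markman's `P = X ⊞ X̂` with the secant sheaf (his Thm. 1.1.2 is the `K`-case; the `L`-Weil
line inside `HW(X × X̂, η̂)` is the route's bet) or an lci Bloch seed via `localClauseAt_of_blochSpread_of_blochSeed`. OPEN. -/
def SeedAnchorAt (d m : ℕ) : Prop :=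
  ∃ (P : AbelianVariety ℂ) (ηP : P ⟶ P) (hW : IsWeilTypeCM P ηP (bqPoly d m) 2 3) (h : complexBetti P.X 2)
    (w : complexBetti P.X (2 * 3)),
    IsPolarizationClass P.dim P.X h ∧
    (∃ s : ℝ, s ≠ 0 ∧ IsKaehlerClass P.dim P.X ((s : ℂ) • h)) ∧
    (∀ x y : complexBetti P.X 1,
      polarizationPairingOne P.X h (P.dim - 1) (pullbackOne P ηP x) y =
        -polarizationPairingOne P.X h (P.dim - 1) x (pullbackOne P ηP y)) ∧
    (haveI : Fact (Irreducible (realPolyQ (bqPoly d m))) := hW.fact_irreducible_map_real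
     HasWeilDiscriminantCM P ηP (bqPoly d m) 2 3 h (splitDiscriminantClassCM (bqPoly d m) 3)) ∧
    IsHyperbolicWeilType P ηP (3 * 2) h ∧
    w ∈ weilClassesField P ηP ((bqPoly d m).comp (Polynomial.X ^ 2)) (2 * 3) ∧ IsRationalClass w ∧ w ≠ 0 ∧
    LocalClauseAt P h w

/-- **lci SEED at `(d, m)`**: the same member data with a BLOCH SEED (`HasBlochSeedAt12`) in place of the local clause. -/
def BlochSeedAt (d m : ℕ) : Prop :=
  ∃ (P : AbelianVariety ℂ) (ηP : P ⟶ P) (hW : IsWeilTypeCM P ηP (bqPoly d m) 2 3) (h : complexBetti P.X 2)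
    (w : complexBetti P.X (2 * 3)),
    IsPolarizationClass P.dim P.X h ∧
    (∃ s : ℝ, s ≠ 0 ∧ IsKaehlerClass P.dim P.X ((s : ℂ) • h)) ∧
    (∀ x y : complexBetti P.X 1,
      polarizationPairingOne P.X h (P.dim - 1) (pullbackOne P ηP x) y =
        -polarizationPairingOne P.X h (P.dim - 1) x (pullbackOne P ηP y)) ∧
    (haveI : Fact (Irreducible (realPolyQ (bqPoly d m))) := hW.fact_irreducible_map_real
     HasWeilDiscriminantCM P ηP (bqPoly d m) 2 3 h (splitDiscriminantClassCM (bqPoly d m) 3)) ∧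
    IsHyperbolicWeilType P ηP (3 * 2) h ∧
    w ∈ weilClassesField P ηP ((bqPoly d m).comp (Polynomial.X ^ 2)) (2 * 3) ∧ IsRationalClass w ∧ w ≠ 0 ∧
    HasBlochSeedAt12 P h w

/-- An lci seed is a seed, granting Bloch's class-level theorem for `(12, 3)` (proved). [cite: Bloch1972Semiregularity, Thm. (7.4)] -/
theorem seedAnchorAt_of_blochSpread_of_blochSeedAt {d m : ℕ} (hB : BlochSemiregularSpread (2 * 3 * 2) 3)
    (hS : BlochSeedAt d m) : SeedAnchorAt d m := by
  obtain ⟨P, ηP, hW, h, w, hpol, hkae, hros, hdisc, hlag, hwW, hwQ, hw0, hseed⟩ := hS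
  exact ⟨P, ηP, hW, h, w, hpol, hkae, hros, hdisc, hlag, hwW, hwQ, hw0, localClauseAt_of_blochSpread_of_blochSeed hB hseed⟩

/-- **REACH at `(d, m)`, POLARIZED TARGETS** — DELIGNE'S FAMILY THROUGH THE SEEDED MEMBER, UP TO ISOGENY AT THE TARGET: for every
seeded polarized hyperbolic member `(P, η_P, h, w)` as in `SeedAnchorAt` and every POLARIZED hyperbolic target `(B, η)` of the same
split `(L,6)`-type (`IsPolarizedHyperbolicWeilTypeCM B η R 2 3`, the NEW crux's hypothesis), there are a smooth projective family `f : 𝒳 ⟶ S` of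
relative dimension `12` (quasi-projective total space, smooth irreducible quasi-projective base: a neat level cover of the
connected Shimura variety `Γ\X⁺` of `(H₁(P,ℚ), L, φ_h)` with its universal abelian scheme), a chart `e' : P ≅ 𝒳_{s₀}`, an
abelian variety `B'` with `η'` and an `L`-EQUIVARIANT ISOGENY `g : B ⟶ B'` (`g ≫ η' = η ≫ g`; Landherr: same rank, split
discriminant and signatures ⟹ `H₁(B,ℚ) ≅ H₁(P,ℚ)` as hermitian `L`-spaces; the target's polarization is GIVEN, so no
positivity lemma is needed — this is exactly what the retarget buys), a chart `e₁ : B' ≅ 𝒳_{s₁}`, and global classes `H ∈ H²(𝒳)` (the universal polarization: fibrewise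
rational `(1,1)`, `e'^*H_{s₀} = h`) and `W ∈ H⁶(𝒳)` (fibrewise rational `(3,3)`: the flat extension of `w` — monodromy
`Γ ⊂ SU(V,φ)` acts on `⋀⁶_L V` by `det_L = 1`, every fibre is of Weil type so `⋀⁶_L H¹ ⊂ H^{3,3}` (Prop. 4.4), theorem of the fixed
part —, `e'^*W_{s₀} = w`) such that `e₁^*W_{s₁}` is a NON-ZERO element of `W_L(B', η') ⊗ ℂ`. VERBATIM the conclusion of the
landed helper `BiquadraticSecantLift.seedReachAt_polarized_of_weilFamilyReachCM` (p606540), which derives it from the named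
Literature fact `deligne1982_weilFamilyReachCM_polarizedSplit` (p606539) by the isogeny invariance of `W_L` and Landherr; hence
PROVED below modulo that fact (`seedReachPol_of_fact`). The `K`-analogue is the tree's named fact `weilFamilyReach_hyperbolic`.
[cite: Deligne1982HodgeCycles, §4 Prop. 4.4, Lemma 4.6, proof of Thm. 4.8 (pp. 32–34), §5] [cite: Landherr1936HermitianForms]
[cite: vanGeemen1994HodgeAV, 5.4–5.5 and proof of Lemma 5.2] [cite: Milne2020HodgeClassesAV, §2 2.1] -/
def SeedReachPolAt (d m : ℕ) : Prop :=
  ∀ (P : AbelianVariety ℂ) (ηP : P ⟶ P) (h : complexBetti P.X 2) (w : complexBetti P.X (2 * 3))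
    [Fact (Irreducible (realPolyQ (bqPoly d m)))],
    IsWeilTypeCM P ηP (bqPoly d m) 2 3 → IsPolarizationClass P.dim P.X h →
    (∃ s : ℝ, s ≠ 0 ∧ IsKaehlerClass P.dim P.X ((s : ℂ) • h)) →
    (∀ x y : complexBetti P.X 1,
      polarizationPairingOne P.X h (P.dim - 1) (pullbackOne P ηP x) y =
        -polarizationPairingOne P.X h (P.dim - 1) x (pullbackOne P ηP y)) →
    HasWeilDiscriminantCM P ηP (bqPoly d m) 2 3 h (splitDiscriminantClassCM (bqPoly d m) 3) →
    IsHyperbolicWeilType P ηP (3 * 2) h →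
    w ∈ weilClassesField P ηP ((bqPoly d m).comp (Polynomial.X ^ 2)) (2 * 3) → IsRationalClass w → w ≠ 0 →
    ∀ (B : AbelianVariety ℂ) (η : B ⟶ B), IsPolarizedHyperbolicWeilTypeCM B η (bqPoly d m) 2 3 →
      ∃ (𝒳 S : SchemeOver ℂ) (f : 𝒳 ⟶ S) (s₀ s₁ : ComplexPoints S) (e' : P.X ≅ fiberOver f s₀)
        (B' : AbelianVariety ℂ) (η' : B' ⟶ B') (g : B ⟶ B') (e₁ : B'.X ≅ fiberOver f s₁)
        (H : complexBetti 𝒳 2) (W : complexBetti 𝒳 (2 * 3)),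
        IsSmoothProjectiveFamily f (2 * 3 * 2) ∧ IsQuasiProjectiveOver 𝒳 ∧ IsQuasiProjectiveOver S ∧
        IrreducibleSpace S.left ∧ AlgebraicGeometry.Smooth S.hom ∧
        (∀ s : ComplexPoints S, IsRationalClass (complexBetti.map (fiberι f s) 2 H) ∧
            IsOfHodgeType (2 * 3 * 2) (fiberOver f s) 2 1 1 (complexBetti.map (fiberι f s) 2 H)) ∧
        (∀ s : ComplexPoints S, IsRationalClass (complexBetti.map (fiberι f s) (2 * 3) W) ∧
            IsOfHodgeType (2 * 3 * 2) (fiberOver f s) (2 * 3) 3 3 (complexBetti.map (fiberι f s) (2 * 3) W)) ∧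
        complexBetti.map e'.hom 2 (complexBetti.map (fiberι f s₀) 2 H) = h ∧
        complexBetti.map e'.hom (2 * 3) (complexBetti.map (fiberι f s₀) (2 * 3) W) = w ∧
        AbelianVariety.IsIsogeny g ∧ g ≫ η' = η ≫ g ∧ B'.dim = 2 * 3 * 2 ∧
        complexBetti.map e₁.hom (2 * 3) (complexBetti.map (fiberι f s₁) (2 * 3) W) ∈
          weilClassesField B' η' ((bqPoly d m).comp (Polynomial.X ^ 2)) (2 * 3) ∧
        complexBetti.map e₁.hom (2 * 3) (complexBetti.map (fiberι f s₁) (2 * 3) W) ≠ 0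

/-- SEED, all `(d, m)` (the registered stub's statement). -/
def SeedAnchors : Prop := ∀ d m : ℕ, 0 < d → 0 < m → ¬ IsSquare m → SeedAnchorAt d m

/-- lci SEED, all `(d, m)`. -/
def BlochSeeds : Prop := ∀ d m : ℕ, 0 < d → 0 < m → ¬ IsSquare m → BlochSeedAt d m

/-- REACH with polarized targets, all `(d, m)` (no longer a stub: `seedReachPol_of_fact`). -/
def SeedReachPol : Prop := ∀ d m : ℕ, 0 < d → 0 < m → ¬ IsSquare m → SeedReachPolAt d m

/-- X1pol for all `(d, m)` in the rung spelling (definitionally the NEW crux `MarkmanBiquadraticTwelvefoldsPolarized`; kept as a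
local name so that exactly ONE theorem of this file concludes the crux decl by name). -/
def X1polAll : Prop := ∀ d m : ℕ, 0 < d → 0 < m → ¬ IsSquare m → X1polAt d m

/-! ## §3 Registered stubs -/

/-- **STUB SEED (rank: hardest; size L; OPEN).** A seeded polarized hyperbolic member of every split biquadratic
`(L,6)`-component. WHY IT MIGHT FAIL: Markman's semiregular secant sheaf is built for `K = ℚ(√-d)` only (twisted by a
2-form); on `X ⊞ X̂` with real multiplication the `L`-Weil LINE `⋀⁶_L H¹` sits inside the 20-dimensional `K`-Weil space and no
semiregular object with `ch₃ ∈ ℚ h³ + W_L` is known; an lci Bloch seed in codimension `3` on an abelian 12-fold is equally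
unknown (complete intersections of divisors give only `h³`-type classes). [cite: Markman2025SecantRealMultiplication, §11.2]
[cite: Markman2025SecantWeil, §1.5] [cite: Bloch1972Semiregularity, Remark (7.5)] -/
theorem stub_seedAnchor : SeedAnchors := by
  sorry

/-- **STUB REACH-FACT (NEW; size M–L FORMALISATION DEBT of a NAMED, ACCEPTED LITERATURE FACT — not a conjecture).**
`Literature.AlgebraicGeometry.HodgeTheory.deligne1982_weilFamilyReachCM_polarizedSplit` (`WeilFamilyReachCMField.lean`, p606539):
Deligne's connected polarized family of split-`(L,e₀p)` Weil-type abelian varieties through a polarized member reaches every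
polarized member of the same type, carrying the universal polarization and the flat Weil class (Deligne 1982 Lemma 4.6, proof of
Thm. 4.8 (a)+(b), §5, for a CM field `L`; Milne 2020 §2). It replaces `prymseed`'s `stub_seedReach`: with polarized targets the
whole REACH statement follows from the fact (`seedReachPol_of_fact`, next). WHY IT MIGHT FAIL (as typed): only through the
carriers — `IsSmoothProjectiveFamily` / `IsQuasiProjectiveOver` for the universal abelian scheme over a neat level cover of
`Γ\X⁺`, and the theorem of the fixed part for `W`; the `K`-analogue `weilFamilyReach_hyperbolic` is carried the same way by
`Cruxes/NonsplitSixfoldCells/Lines/birth.lean: stub_reach`. [cite: Deligne1982HodgeCycles, §4 Lemma 4.6, proof of Thm. 4.8, §5]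
[cite: Milne2020HodgeClassesAV, §2 2.1] [cite: Landherr1936HermitianForms] -/
theorem stub_reachFact : Literature.AlgebraicGeometry.HodgeTheory.deligne1982_weilFamilyReachCM_polarizedSplit := by
  sorry

/-- **REACH IS PROVED modulo the named fact** (by the landed helper of p606540; the two `bqPoly`s agree definitionally).
[cite: Deligne1982HodgeCycles, §4 proof of Thm. 4.8] [cite: Landherr1936HermitianForms] -/
theorem seedReachPol_of_fact
    (hF : Literature.AlgebraicGeometry.HodgeTheory.deligne1982_weilFamilyReachCM_polarizedSplit) : SeedReachPol :=
  fun d m _ _ _ => Summit.HodgeConjecture.HodgeConjecture.BiquadraticSecantLift.seedReachAt_polarized_of_weilFamilyReachCM hF d m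

/-- **RUNG (T3 PLAN-ONLY; same NAME as `Birth.stub_rung_d1_m3` / `PrymSeed.stub_rung_d1_m3`, statement now POLARIZED)**: X1pol at
`(d, m) = (1, 3)`, `L = ℚ(i, √3) = ℚ(ζ₁₂)`. PLAN on this line: `rung_d1_m3_of_prymSeed_of_fact` — prove `PrymSeed13` (the seed AT
the refereed `ℤ/12`-Prym anchor, §5) and discharge the named fact; or `rung_d1_m3_of_seedAt` with any seeded member of the
`ℚ(ζ₁₂)` split component. NOT PROVED. [cite: Markman2025SecantRealMultiplication, Thm. 1.1.2] [cite: Schoen1988HodgeWeil, Cor. 3.1] -/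
theorem stub_rung_d1_m3 : X1polAt 1 3 := by
  sorry

/-! ## §4 PROVED amplification: SEED ∧ REACH ⟹ X1 (at fixed `(d, m)`, for all `(d, m)`, the rung plan, the crux BY NAME) -/

/-- **AMPLIFICATION AT FIXED `(d, m)` (no sorry).** Local clause at the seeded fibre ⟹ a Euclidean-open set of algebraic fibres
⟹ every fibre algebraic (algebraicity locus = countable union of closed algebraic subsets, one with interior) ⟹ `W_{s₁}` algebraic
(Lefschetz (1,1) and Kleiman for `q·H_{s₁}³` on the abelian fibre) ⟹ `g^*W_{s₁}` is a non-zero rational algebraic class of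
`W_L(B) ⊗ ℂ` ⟹ all of `W_L(B) ⊗ ℂ` is algebraic (one-class lemma). [cite: CharlesSchnell2014Notes, Prop. 11.3.11]
[cite: Markman2025SurveySecant, §4] [cite: vanGeemen1994HodgeAV, 3.6–3.7] [cite: VoisinHodgeII2003, §9.2.4 Prop. 9.20] -/
theorem x1polAt_of_seed (d m : ℕ) (hA : SeedAnchorAt d m) (hR : SeedReachPolAt d m) : X1polAt d m := by
  intro B η hH c hc hcQ _
  have hW : IsWeilTypeCM B η (bqPoly d m) 2 3 := hH.isWeilTypeCM
  obtain ⟨P, ηP, hWP, h, w, hpol, hkae, hros, hdisc, hlag, hwW, hwQ, hw0, hloc⟩ := hA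
  haveI : Fact (Irreducible (realPolyQ (bqPoly d m))) := hWP.fact_irreducible_map_real
  obtain ⟨𝒳, S, f, s₀, s₁, e', B', η', g, e₁, H, W, hf, h𝒳, hS, hirr, hsm, hHfib, hWfib, hH₀, hW₀, hgi, hgc, hB'dim,
      hW₁mem, hW₁ne⟩ :=
    hR P ηP h w hWP hpol hkae hros hdisc hlag hwW hwQ hw0 B η hH
  haveI := hirr
  -- (1) the local clause at the seeded fibre `s₀`
  obtain ⟨U, q, hUo, hs₀U, hUalg⟩ := hloc f hf h𝒳 hS hirr hsm H W hHfib hWfib s₀ e' hH₀ hW₀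
  -- (2) the global class `q·H³ + W` is algebraic on an open set of fibres, hence on every fibre
  set Bq : complexBetti 𝒳 (2 * 3) := ((q : ℚ) : ℂ) • cupPowTwo H 3 + W with hBqdef
  have hres : ∀ s : ComplexPoints S, complexBetti.map (fiberι f s) (2 * 3) Bq =
      ((q : ℚ) : ℂ) • cupPowTwo (complexBetti.map (fiberι f s) 2 H) 3 + complexBetti.map (fiberι f s) (2 * 3) W := by
    intro s
    rw [hBqdef, map_add, map_smul, complexBetti_map_cupPowTwo']
  have hUalg' : ∀ t ∈ U, complexBetti.map (fiberι f t) (2 * 3) Bq ∈ algebraicClasses (fiberOver f t) 3 := by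
    intro t ht
    rw [hres]
    exact hUalg t ht
  have hall := mem_algebraicClasses_of_isOpen_subset_algebraicityLocus f h𝒳 hS hsm hf Bq hUo ⟨s₀, hs₀U⟩ hUalg'
  have halg₁ : ((q : ℚ) : ℂ) • cupPowTwo (complexBetti.map (fiberι f s₁) 2 H) 3 +
      complexBetti.map (fiberι f s₁) (2 * 3) W ∈ algebraicClasses (fiberOver f s₁) 3 := by
    rw [← hres]
    exact hall s₁
  -- (3) `H_{s₁}³` is algebraic (Lefschetz (1,1) + Kleiman on the abelian variety `B' ≅ 𝒳_{s₁}`), hence so is `W_{s₁}`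
  have hB'sp : IsSmoothProjective (2 * 3 * 2) B'.X := by
    have h' : IsSmoothProjective B'.dim B'.X := AbelianVariety.isSmoothProjective_holds (A := B')
    rwa [hB'dim] at h'
  have hh₁ : complexBetti.map e₁.hom 2 (complexBetti.map (fiberι f s₁) 2 H) ∈ algebraicClasses B'.X 1 :=
    lefschetzOneOne_rational_holds hB'sp _ ((isRationalClass_map_iff_of_iso e₁).2 (hHfib s₁).1)
      ((isOfHodgeType_map_iff_of_iso e₁).2 (hHfib s₁).2)
  have hh₃ : complexBetti.map e₁.hom (2 * 3) (cupPowTwo (complexBetti.map (fiberι f s₁) 2 H) 3) ∈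
      algebraicClasses B'.X 3 := by
    rw [complexBetti_map_cupPowTwo']
    exact cupPowTwo_mem_algebraicClasses_abelian B' hh₁ 2
  have hH₃ : cupPowTwo (complexBetti.map (fiberι f s₁) 2 H) 3 ∈ algebraicClasses (fiberOver f s₁) 3 :=
    (mem_algebraicClasses_map_iff_of_iso e₁).1 hh₃
  have hW₁ : complexBetti.map (fiberι f s₁) (2 * 3) W ∈ algebraicClasses (fiberOver f s₁) 3 := by
    have h' := Submodule.sub_mem _ halg₁ (Submodule.smul_mem _ ((q : ℚ) : ℂ) hH₃)
    rwa [add_sub_cancel_left] at h'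
  -- (4) transport `W_{s₁}` to `B'` (chart) and to `B` (the `L`-equivariant isogeny `g`)
  set w₁ : complexBetti B'.X (2 * 3) := complexBetti.map e₁.hom (2 * 3) (complexBetti.map (fiberι f s₁) (2 * 3) W)
    with hw₁def
  have hw₁alg : w₁ ∈ algebraicClasses B'.X 3 := (mem_algebraicClasses_map_iff_of_iso e₁).2 hW₁
  have hw₁Q : IsRationalClass w₁ := (isRationalClass_map_iff_of_iso e₁).2 (hWfib s₁).1
  have hBsp : IsSmoothProjective B.dim B.X := AbelianVariety.isSmoothProjective_holds (A := B)
  have hgw : complexBetti.map g.hom.hom.hom (2 * 3) w₁ ∈ weilClassesField B η ((bqPoly d m).comp (Polynomial.X ^ 2)) (2 * 3) :=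
    map_mem_weilClassesField_of_comm hgc hW₁mem
  have hgwQ : IsRationalClass (complexBetti.map g.hom.hom.hom (2 * 3) w₁) := hw₁Q.map _
  have hgwalg : complexBetti.map g.hom.hom.hom (2 * 3) w₁ ∈ algebraicClasses B.X 3 :=
    map_mem_algebraicClasses_of_abelianVariety hBsp B' g.hom.hom.hom hw₁alg
  have hgw0 : complexBetti.map g.hom.hom.hom (2 * 3) w₁ ≠ 0 := fun h0 =>
    hW₁ne ((complexBetti_map_bijective_of_isIsogeny hgi (2 * 3)).1 (h0.trans (map_zero _).symm))
  -- (5) one non-zero rational algebraic Weil class suffices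
  have hle := weilClassesField_le_algebraicClasses_of_isRationalClass_of_ne_zero hW.natDegree_comp hW.irreducible
    hW.eval₂_eq_zero hW.degree_mul_rank hW.k_pos hgw hgwQ hgw0 hgwalg
  exact hle hc

/-- lci variant: Bloch's class-level theorem for `(12, 3)` ∧ an lci seed ∧ REACH ⟹ X1 at `(d, m)` (proved). -/
theorem x1polAt_of_blochSeed (d m : ℕ) (hB : BlochSemiregularSpread (2 * 3 * 2) 3) (hS : BlochSeedAt d m)
    (hR : SeedReachPolAt d m) : X1polAt d m :=
  x1polAt_of_seed d m (seedAnchorAt_of_blochSpread_of_blochSeedAt hB hS) hR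

/-- **THE RUNG'S PLAN on this line (proved): `SeedAnchorAt 1 3 → SeedReachPolAt 1 3 → X1polAt 1 3`.** -/
theorem rung_d1_m3_of_seedAt (hA : SeedAnchorAt 1 3) (hR : SeedReachPolAt 1 3) : X1polAt 1 3 :=
  x1polAt_of_seed 1 3 hA hR

/-- SEED ∧ REACH for all `(d, m)` ⟹ X1 for all `(d, m)` (proved). -/
theorem x1polAll_of_seed (hA : SeedAnchors) (hR : SeedReachPol) : X1polAll :=
  fun d m hd hm hsq => x1polAt_of_seed d m (hA d m hd hm hsq) (hR d m hd hm hsq)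

/-- SEED for all `(d, m)` ∧ THE NAMED FACT ⟹ X1pol for all `(d, m)` (proved: REACH is no longer an input). -/
theorem x1polAll_of_seed_of_fact (hA : SeedAnchors)
    (hF : Literature.AlgebraicGeometry.HodgeTheory.deligne1982_weilFamilyReachCM_polarizedSplit) : X1polAll :=
  x1polAll_of_seed hA (seedReachPol_of_fact hF)

/-- `X1polAll` IS the NEW crux (definitional: `bqPoly d m` is the route's polynomial, `6 = 2·3`). -/
theorem x1polAll_iff :
    X1polAll ↔ Summit.HodgeConjecture.HodgeConjecture.Theses.BiquadraticSecantLift.MarkmanBiquadraticTwelvefoldsPolarized :=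
  ⟨fun h d m hd hm hsq B η hH c hc hcQ hcH => h d m hd hm hsq B η hH c hc hcQ hcH,
    fun h d m hd hm hsq B η hH c hc hcQ hcH => h d m hd hm hsq B η hH c hc hcQ hcH⟩

/-- **X1 ⟹ X1pol** (the retarget is a WEAKENING of the binder: a polarized target is in particular a class-level one), stated on the
local name `X1polAll` so that only `MarkmanBiquadraticTwelvefoldsPolarized_of_stubs` concludes the crux decl by name. The converse
holds modulo the (true, class-field-theoretic, untyped) positivity lemma of `POSITIVITY-LEMMA-x2p1-g8.md`; it is not needed anywhere. -/
theorem x1polAll_of_x1 (h : Summit.HodgeConjecture.HodgeConjecture.Theses.BiquadraticSecantLift.MarkmanBiquadraticTwelvefolds) :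
    X1polAll :=
  fun d m hd hm hsq B η hP c hc hcQ hcH => h d m hd hm hsq B η hP.isHyperbolicWeilTypeCM c hc hcQ hcH

/-- **COMPOSITION — concludes the NEW crux BY NAME from the registered stubs** (sorries live only inside `stub_seedAnchor`,
`stub_reachFact`): `stub_seedAnchor → stub_reachFact → MarkmanBiquadraticTwelvefoldsPolarized` via `x1polAll_of_seed_of_fact`. -/
theorem MarkmanBiquadraticTwelvefoldsPolarized_of_stubs :
    Summit.HodgeConjecture.HodgeConjecture.Theses.BiquadraticSecantLift.MarkmanBiquadraticTwelvefoldsPolarized :=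
  x1polAll_iff.1 (x1polAll_of_seed_of_fact stub_seedAnchor stub_reachFact)


/-! ## §5 THE LEVER AT THE REFEREED ANCHOR (verbatim from `Lines/prymseed.lean` §5, plus `rung_d1_m3_of_prymSeed_of_fact`):
a seeded member ON the genus-`4` `ℤ/12`-Prym locus -/

/-- The BODY of `SeedAnchorAt d m` at a GIVEN member `(P, η_P)`: Weil type for `L = ℚ[T]/(R_(d,m)(T²))` of `L`-rank `6`, a
polarization class `h` some real multiple of which is Kähler, Rosati = complex conjugation on `L`, split discriminant, an
`η_P^*`-stable rational Lagrangian, a non-zero rational `L`-Weil class `w`, and the local clause for `(h, w)`.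
[cite: Deligne1982HodgeCycles, §4 Cor. 4.2 and Thm. 4.8] [cite: Bloch1972Semiregularity, Thm. (7.4)] -/
def SeedBodyAt (d m : ℕ) (P : AbelianVariety ℂ) (ηP : P ⟶ P) : Prop :=
  ∃ (hW : IsWeilTypeCM P ηP (bqPoly d m) 2 3) (h : complexBetti P.X 2) (w : complexBetti P.X (2 * 3)),
    IsPolarizationClass P.dim P.X h ∧
    (∃ s : ℝ, s ≠ 0 ∧ IsKaehlerClass P.dim P.X ((s : ℂ) • h)) ∧
    (∀ x y : complexBetti P.X 1,
      polarizationPairingOne P.X h (P.dim - 1) (pullbackOne P ηP x) y =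
        -polarizationPairingOne P.X h (P.dim - 1) x (pullbackOne P ηP y)) ∧
    (haveI : Fact (Irreducible (realPolyQ (bqPoly d m))) := hW.fact_irreducible_map_real
     HasWeilDiscriminantCM P ηP (bqPoly d m) 2 3 h (splitDiscriminantClassCM (bqPoly d m) 3)) ∧
    IsHyperbolicWeilType P ηP (3 * 2) h ∧
    w ∈ weilClassesField P ηP ((bqPoly d m).comp (Polynomial.X ^ 2)) (2 * 3) ∧ IsRationalClass w ∧ w ≠ 0 ∧
    LocalClauseAt P h w

/-- The BODY of `BlochSeedAt d m` at a given member: the same data with a Bloch seed (`HasBlochSeedAt12`) for `(h, w)`.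
[cite: Bloch1972Semiregularity, Thm. (7.4) and Remark (7.5)] [cite: BuchweitzFlenner2003, Thm. 5.2] -/
def BlochBodyAt (d m : ℕ) (P : AbelianVariety ℂ) (ηP : P ⟶ P) : Prop :=
  ∃ (hW : IsWeilTypeCM P ηP (bqPoly d m) 2 3) (h : complexBetti P.X 2) (w : complexBetti P.X (2 * 3)),
    IsPolarizationClass P.dim P.X h ∧
    (∃ s : ℝ, s ≠ 0 ∧ IsKaehlerClass P.dim P.X ((s : ℂ) • h)) ∧
    (∀ x y : complexBetti P.X 1,
      polarizationPairingOne P.X h (P.dim - 1) (pullbackOne P ηP x) y =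
        -polarizationPairingOne P.X h (P.dim - 1) x (pullbackOne P ηP y)) ∧
    (haveI : Fact (Irreducible (realPolyQ (bqPoly d m))) := hW.fact_irreducible_map_real
     HasWeilDiscriminantCM P ηP (bqPoly d m) 2 3 h (splitDiscriminantClassCM (bqPoly d m) 3)) ∧
    IsHyperbolicWeilType P ηP (3 * 2) h ∧
    w ∈ weilClassesField P ηP ((bqPoly d m).comp (Polynomial.X ^ 2)) (2 * 3) ∧ IsRationalClass w ∧ w ≠ 0 ∧
    HasBlochSeedAt12 P h w

/-- `SeedAnchorAt d m` is «some member carries a seed body» (definitional). -/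
theorem seedAnchorAt_iff_exists_body (d m : ℕ) :
    SeedAnchorAt d m ↔ ∃ (P : AbelianVariety ℂ) (ηP : P ⟶ P), SeedBodyAt d m P ηP :=
  Iff.rfl

/-- `BlochSeedAt d m` is «some member carries a Bloch body» (definitional). -/
theorem blochSeedAt_iff_exists_body (d m : ℕ) :
    BlochSeedAt d m ↔ ∃ (P : AbelianVariety ℂ) (ηP : P ⟶ P), BlochBodyAt d m P ηP :=
  Iff.rfl

/-- A Bloch body is a seed body, granting the refereed class-level Bloch theorem for `(12, 3)` (proved, via §1's bridge).
[cite: Bloch1972Semiregularity, Thm. (7.4)] [cite: BuchweitzFlenner2003, Thm. 5.2] -/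
theorem seedBodyAt_of_blochSpread_of_blochBodyAt (hB : BlochSemiregularSpread (2 * 3 * 2) 3) {d m : ℕ}
    {P : AbelianVariety ℂ} {ηP : P ⟶ P} (hS : BlochBodyAt d m P ηP) : SeedBodyAt d m P ηP := by
  obtain ⟨hW, h, w, hpol, hkae, hros, hdisc, hlag, hwW, hwQ, hw0, hseed⟩ := hS
  exact ⟨hW, h, w, hpol, hkae, hros, hdisc, hlag, hwW, hwQ, hw0, localClauseAt_of_blochSpread_of_blochSeed hB hseed⟩

/-- `R_(1,3)(S) = S² + 8S + 4` — the cell `(d, m) = (1, 3)`, `L = ℚ(i, √3) = ℚ(ζ₁₂)`; literally the polynomial of the two Prym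
facts of `WeilClassesCyclicPrymDegreeTwelve`. [cite: PatelZhang2025PrymHodge, §5.1] -/
theorem bqPoly_one_three :
    bqPoly 1 3 = Polynomial.X ^ 2 + Polynomial.C (8 : ℤ) * Polynomial.X + Polynomial.C (4 : ℤ) := by
  unfold bqPoly
  norm_num

/-- **The genus-`4` `ℤ/12`-Prym binder block** (the hypotheses of `Schoen1988_cyclicPrym_weilClasses_algebraic_degreeTwelve_allGenera`
and `cyclicPrymTwelve_isHyperbolicWeilTypeCM_allGenera` at `n = 3`): `C` a smooth projective curve with Jacobian `𝒥` of dimension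
`37 = 12·3 + 1`, `α` an automorphism with `α¹² = 𝟙` whose powers `α⁴`, `α⁶` have no fixed complex point (a FREE `ℤ/12`-action, so
`C → C' = C/(ℤ/12)` is étale onto a genus-`4` curve), `s = α_*`, `Φ = Φ₁₂(s) = 𝟙 - s² + s⁴` (so `(ker Φ)⁰ = B_prim`, a twelvefold),
`s_B` the restriction of `s` to `B`, and the Weil generator `η = -𝟙 + 2s_B² + s_B³` (`η⁴ + 8η² + 4 = 0`). PREDICATE.
[cite: Schoen1988HodgeWeil, Thm. 2.0 and Cor. 3.1 at (q, m, r) = (4, 12, 0)] [cite: PatelZhang2025PrymHodge, Lemma 5.1 and Def. 5.2] -/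
def IsPrymTwelvefold (C : SchemeOver ℂ) (𝒥 : Jacobian C) (α : C ⟶ C) (s Φ : 𝒥.J ⟶ 𝒥.J)
    (sB η : AbelianVariety.kerComponent Φ ⟶ AbelianVariety.kerComponent Φ) : Prop :=
  IsSmoothProjective 1 C ∧ 𝒥.J.dim = 37 ∧
    α ≫ α ≫ α ≫ α ≫ α ≫ α ≫ α ≫ α ≫ α ≫ α ≫ α ≫ α = 𝟙 C ∧
    (∀ P : ComplexPoints C, P ≫ (α ≫ α ≫ α ≫ α) ≠ P ∧ P ≫ (α ≫ α ≫ α ≫ α ≫ α ≫ α) ≠ P) ∧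
    s = 𝒥.pushforward 𝒥 α ∧ Φ = 𝟙 𝒥.J - s ≫ s + s ≫ s ≫ s ≫ s ∧
    sB ≫ AbelianVariety.kerComponentι Φ = AbelianVariety.kerComponentι Φ ≫ s ∧
    η = -𝟙 _ + 2 • (sB ≫ sB) + sB ≫ sB ≫ sB

/-- **`PrymSeed13` — THE LEVER AT THE ANCHOR (T3 designate; OPEN).** Some genus-`4` `ℤ/12`-Prym twelvefold
`(B, η) = ((ker Φ₁₂(α_*))⁰, -𝟙 + 2s_B² + s_B³)` carries a SEED BODY for the cell `(1, 3)`: a polarization class `h` (Kähler multiple,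
Rosati = complex conjugation on `ℚ(ζ₁₂)`, split discriminant, `η^*`-stable rational Lagrangian), a non-zero rational `ℚ(ζ₁₂)`-Weil
class `w ∈ U_prim ⊗ ℂ ⊂ H⁶(B)`, and the LOCAL CLAUSE `LocalClauseAt B h w`. It is `SeedAnchorAt 1 3` LOCALISED to the `9`-dimensional
anchor locus, where the clause's base-point requirement holds for all candidate data (`prym_basepoint`) and explicit curve-built
cycles and sheaves exist to be tested for semiregularity. [cite: Schoen1988HodgeWeil, Cor. 3.1 and pp. 25–26]
[cite: Markman2025SecantRealMultiplication, Thm. 1.1.2] [cite: Bloch1972Semiregularity, Thm. (7.4)] -/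
def PrymSeed13 : Prop :=
  ∃ (C : SchemeOver ℂ) (𝒥 : Jacobian C) (α : C ⟶ C) (s Φ : 𝒥.J ⟶ 𝒥.J)
    (sB η : AbelianVariety.kerComponent Φ ⟶ AbelianVariety.kerComponent Φ),
    IsPrymTwelvefold C 𝒥 α s Φ sB η ∧ SeedBodyAt 1 3 (AbelianVariety.kerComponent Φ) η

/-- **`PrymBlochSeed13` — the lci entrance at the anchor**: some genus-`4` `ℤ/12`-Prym twelvefold carries a BLOCH BODY for the cell
`(1, 3)` (an integral, Bloch-semiregular lci `Z ⊂ B` of codimension `3` supporting `q·h³ + w`). PREDICATE (not a stub: it implies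
`PrymSeed13` by `prymSeed13_of_blochSpread`). [cite: Bloch1972Semiregularity, Thm. (7.4) and Remark (7.5)] -/
def PrymBlochSeed13 : Prop :=
  ∃ (C : SchemeOver ℂ) (𝒥 : Jacobian C) (α : C ⟶ C) (s Φ : 𝒥.J ⟶ 𝒥.J)
    (sB η : AbelianVariety.kerComponent Φ ⟶ AbelianVariety.kerComponent Φ),
    IsPrymTwelvefold C 𝒥 α s Φ sB η ∧ BlochBodyAt 1 3 (AbelianVariety.kerComponent Φ) η

/-- **STUB — THE LEVER AT THE ANCHOR (T3 designate `stub_prymSeed13`; PLAN-ONLY; size L; OPEN).** A seeded member ON the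
`ℤ/12`-Prym locus of the `(1,3)` cell. NAMED TECHNIQUES: (i) Bloch's theorem for an lci semiregular curve-built cycle on `B ⊂ J(C)`
with class `q·h³ + w` (`prymSeed13_of_blochSpread`); (ii) a Buchweitz–Flenner semiregular sheaf / perfect complex with `ch₃ ∈ ℚh³ + w`
(+ divisor terms); (iii) Markman's `B`-secant pair (his Thm. 1.1.2 at `K = ℚ(√3)(i)`, `d = 6`) on the RM sixfold factor `X` of a
DIHEDRAL Prym member `B ~ X × X̂`, with `κ(Φ(F₁ ⊠ F₂^∨))` algebraic near the point. WHY IT MIGHT FAIL: the variational Hodge conjecture is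
open and no semiregular codimension-`3` object on an abelian `12`-fold of this family is known (Markman postpones the `[K:ℚ] = 4`
sheaves in print); curve-remembering cycles deform only over the `9`-dimensional Prym locus and are therefore NOT semiregular when
their class stays Hodge on the `18`-dimensional family (Bloch, contrapositive); every candidate must first pass the class test
`ch ∈ ⟨ℚh ⊕ ℚ√3·h, W_L⟩`. NOT PROVED. [cite: Markman2025SecantRealMultiplication, §1.1 (last paragraph) and Thm. 1.1.2]
[cite: Bloch1972Semiregularity, Thm. (7.4), Remark (7.5)] [cite: BuchweitzFlenner2003, Thm. 5.1] [cite: Schoen1988HodgeWeil, pp. 12–13, 24–26] -/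
theorem stub_prymSeed13 : PrymSeed13 := by
  sorry

/-- **A Prym seed is a seed of the cell `(1, 3)`** (proved: forget where the member came from). -/
theorem seedAnchorAt13_of_prymSeed (hA : PrymSeed13) : SeedAnchorAt 1 3 := by
  obtain ⟨C, 𝒥, α, s, Φ, sB, η, -, hbody⟩ := hA
  exact ⟨AbelianVariety.kerComponent Φ, η, hbody⟩

/-- **The lci entrance at the anchor** (proved): Bloch's class-level theorem for `(12, 3)` ∧ a Prym Bloch body ⟹ a Prym seed.
[cite: Bloch1972Semiregularity, Thm. (7.4)] -/
theorem prymSeed13_of_blochSpread (hB : BlochSemiregularSpread (2 * 3 * 2) 3) (hS : PrymBlochSeed13) : PrymSeed13 := by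
  obtain ⟨C, 𝒥, α, s, Φ, sB, η, hd, hbody⟩ := hS
  exact ⟨C, 𝒥, α, s, Φ, sB, η, hd, seedBodyAt_of_blochSpread_of_blochBodyAt hB hbody⟩

/-- **THE RUNG'S PLAN ON THIS LINE (proved): LEVER AT THE ANCHOR ∧ REACH ⟹ the whole `(1, 3)` cell `X1polAt 1 3`**
("output = the whole 18-dimensional component", by §4's amplification `x1polAt_of_seed`).
[cite: Deligne1982HodgeCycles, §4 proof of Thm. 4.8] [cite: CharlesSchnell2014Notes, Prop. 11.3.11] -/
theorem rung_d1_m3_of_prymSeed (hA : PrymSeed13) (hR : SeedReachPolAt 1 3) : X1polAt 1 3 :=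
  x1polAt_of_seed 1 3 (seedAnchorAt13_of_prymSeed hA) hR

/-- `3` is not a square. -/
theorem not_isSquare_three : ¬ IsSquare (3 : ℕ) := by
  rintro ⟨r, hr⟩
  have h : r ≤ 3 := by nlinarith
  interval_cases r <;> omega

/-- **THE RUNG'S PLAN AFTER THE RETARGET (proved): LEVER AT THE ANCHOR ∧ THE NAMED FACT ⟹ the whole `(1, 3)` cell `X1polAt 1 3`.**
Closing `stub_prymSeed13` and formalising `deligne1982_weilFamilyReachCM_polarizedSplit` closes the rung `stub_rung_d1_m3`.
[cite: Deligne1982HodgeCycles, §4 Lemma 4.6, proof of Thm. 4.8] [cite: Schoen1988HodgeWeil, Cor. 3.1] -/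
theorem rung_d1_m3_of_prymSeed_of_fact (hA : PrymSeed13)
    (hF : Literature.AlgebraicGeometry.HodgeTheory.deligne1982_weilFamilyReachCM_polarizedSplit) : X1polAt 1 3 :=
  rung_d1_m3_of_prymSeed hA (seedReachPol_of_fact hF 1 3 one_pos (by norm_num) not_isSquare_three)

/-- lci variant of the rung's plan (proved). [cite: Bloch1972Semiregularity, Thm. (7.4)] -/
theorem rung_d1_m3_of_prymBlochSeed (hB : BlochSemiregularSpread (2 * 3 * 2) 3) (hS : PrymBlochSeed13)
    (hR : SeedReachPolAt 1 3) : X1polAt 1 3 :=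
  rung_d1_m3_of_prymSeed (prymSeed13_of_blochSpread hB hS) hR

/-- **MEMBERSHIP (granted the DERIVED placement statement): every genus-`4` `ℤ/12`-Prym twelvefold is a member of the cell `(1, 3)`**
— `IsHyperbolicWeilTypeCM B η (bqPoly 1 3) 2 3` (in particular `IsWeilTypeCM B η (bqPoly 1 3) 2 3`, the first conjunct of the seed body,
and the `Fact` that `ℚ[S]/(R_(1,3)) = ℚ(√3)` is a field). [cite: PatelZhang2025PrymHodge, Lemma 5.1 and §5.1] [cite: Deligne1982HodgeCycles, §4 Cor. 4.2] -/
theorem prym_mem_cell (hP : cyclicPrymTwelve_isHyperbolicWeilTypeCM_allGenera) {C : SchemeOver ℂ} {𝒥 : Jacobian C}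
    {α : C ⟶ C} {s Φ : 𝒥.J ⟶ 𝒥.J} {sB η : AbelianVariety.kerComponent Φ ⟶ AbelianVariety.kerComponent Φ}
    (hd : IsPrymTwelvefold C 𝒥 α s Φ sB η) :
    IsHyperbolicWeilTypeCM (AbelianVariety.kerComponent Φ) η (bqPoly 1 3) 2 3 := by
  obtain ⟨hC, hdim, hα, hfree, hs, hΦ, hsB, hη⟩ := hd
  rw [bqPoly_one_three]
  exact hP 3 (by norm_num) C 𝒥 α hC (hdim.trans (by norm_num)) hα hfree s Φ hs hΦ sB η hsB hη

/-- **BASE-POINT TEST AT THE ANCHOR (proved; consumes Schoen's REFEREED fact).** At a genus-`4` `ℤ/12`-Prym twelvefold, for EVERY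
polarization class `h`, EVERY class `w` of the `ℚ(ζ₁₂)`-Weil space and EVERY `q ∈ ℚ`, the class `q·h³ + w` is algebraic (`h³` by
`IsPolarizationClass.mem_algebraicClasses` and the abelian-variety cup-product closure; `w` by Schoen Cor. 3.1). This is the
requirement `s₀ ∈ U` of `LocalClauseAt B h w` — open at a general member of the cell, discharged at the anchor for all candidates.
[cite: Schoen1988HodgeWeil, Cor. 3.1 (p. 24)] [cite: PatelZhang2025PrymHodge, Thm. 5.3] [cite: VoisinHodgeII2003, proof of Lemma 9.18] -/
theorem prym_basepoint (hS : Schoen1988_cyclicPrym_weilClasses_algebraic_degreeTwelve_allGenera) {C : SchemeOver ℂ}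
    {𝒥 : Jacobian C} {α : C ⟶ C} {s Φ : 𝒥.J ⟶ 𝒥.J}
    {sB η : AbelianVariety.kerComponent Φ ⟶ AbelianVariety.kerComponent Φ} (hd : IsPrymTwelvefold C 𝒥 α s Φ sB η)
    {h : complexBetti (AbelianVariety.kerComponent Φ).X 2}
    (hpol : IsPolarizationClass (AbelianVariety.kerComponent Φ).dim (AbelianVariety.kerComponent Φ).X h)
    {w : complexBetti (AbelianVariety.kerComponent Φ).X (2 * 3)}
    (hw : w ∈ weilClassesField (AbelianVariety.kerComponent Φ) η ((bqPoly 1 3).comp (Polynomial.X ^ 2)) (2 * 3)) (q : ℚ) :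
    ((q : ℚ) : ℂ) • cupPowTwo h 3 + w ∈ algebraicClasses (AbelianVariety.kerComponent Φ).X 3 := by
  obtain ⟨hC, hdim, hα, hfree, hs, hΦ, hsB, hη⟩ := hd
  rw [bqPoly_one_three] at hw
  have hwalg : w ∈ algebraicClasses (AbelianVariety.kerComponent Φ).X 3 :=
    hS 3 (by norm_num) C 𝒥 α hC (hdim.trans (by norm_num)) hα hfree s Φ hs hΦ sB η hsB hη w hw
  have hh₃ : cupPowTwo h 3 ∈ algebraicClasses (AbelianVariety.kerComponent Φ).X 3 :=
    cupPowTwo_mem_algebraicClasses_abelian (AbelianVariety.kerComponent Φ) hpol.mem_algebraicClasses 2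
  exact Submodule.add_mem _ (Submodule.smul_mem _ _ hh₃) hwalg

/-- **REDUCTION TO LOCAL DATA AT ONE PRYM MEMBER (proved; consumes the placement statement).** `PrymSeed13` follows from: one
genus-`4` `ℤ/12`-Prym twelvefold `(B, η)`, a class `h` with the five polarization properties, a non-zero rational `ℚ(ζ₁₂)`-Weil
class `w`, and `LocalClauseAt B h w` — Weil-type-ness for `R_(1,3)` being supplied by `prym_mem_cell`. (The `Fact` binder is
available as `(prym_mem_cell hP hd).isWeilTypeCM.fact_irreducible_map_real`.) [cite: Deligne1982HodgeCycles, §4 Cor. 4.2 and Thm. 4.8] -/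
theorem prymSeed13_of_localData (hP : cyclicPrymTwelve_isHyperbolicWeilTypeCM_allGenera) {C : SchemeOver ℂ}
    {𝒥 : Jacobian C} {α : C ⟶ C} {s Φ : 𝒥.J ⟶ 𝒥.J}
    {sB η : AbelianVariety.kerComponent Φ ⟶ AbelianVariety.kerComponent Φ} (hd : IsPrymTwelvefold C 𝒥 α s Φ sB η)
    [Fact (Irreducible (realPolyQ (bqPoly 1 3)))]
    (h : complexBetti (AbelianVariety.kerComponent Φ).X 2) (w : complexBetti (AbelianVariety.kerComponent Φ).X (2 * 3))
    (hpol : IsPolarizationClass (AbelianVariety.kerComponent Φ).dim (AbelianVariety.kerComponent Φ).X h)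
    (hkae : ∃ s : ℝ, s ≠ 0 ∧
      IsKaehlerClass (AbelianVariety.kerComponent Φ).dim (AbelianVariety.kerComponent Φ).X ((s : ℂ) • h))
    (hros : ∀ x y : complexBetti (AbelianVariety.kerComponent Φ).X 1,
      polarizationPairingOne (AbelianVariety.kerComponent Φ).X h ((AbelianVariety.kerComponent Φ).dim - 1)
          (pullbackOne (AbelianVariety.kerComponent Φ) η x) y =
        -polarizationPairingOne (AbelianVariety.kerComponent Φ).X h ((AbelianVariety.kerComponent Φ).dim - 1) x
          (pullbackOne (AbelianVariety.kerComponent Φ) η y))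
    (hdisc : HasWeilDiscriminantCM (AbelianVariety.kerComponent Φ) η (bqPoly 1 3) 2 3 h
      (splitDiscriminantClassCM (bqPoly 1 3) 3))
    (hlag : IsHyperbolicWeilType (AbelianVariety.kerComponent Φ) η (3 * 2) h)
    (hwW : w ∈ weilClassesField (AbelianVariety.kerComponent Φ) η ((bqPoly 1 3).comp (Polynomial.X ^ 2)) (2 * 3))
    (hwQ : IsRationalClass w) (hw0 : w ≠ 0) (hloc : LocalClauseAt (AbelianVariety.kerComponent Φ) h w) :
    PrymSeed13 :=
  ⟨C, 𝒥, α, s, Φ, sB, η, hd, (prym_mem_cell hP hd).isWeilTypeCM, h, w, hpol, hkae, hros, hdisc, hlag, hwW, hwQ, hw0, hloc⟩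

/-- lci variant of the reduction (proved): a Bloch seed at one Prym member gives `PrymBlochSeed13`. [cite: Bloch1972Semiregularity, Thm. (7.4)] -/
theorem prymBlochSeed13_of_localData (hP : cyclicPrymTwelve_isHyperbolicWeilTypeCM_allGenera) {C : SchemeOver ℂ}
    {𝒥 : Jacobian C} {α : C ⟶ C} {s Φ : 𝒥.J ⟶ 𝒥.J}
    {sB η : AbelianVariety.kerComponent Φ ⟶ AbelianVariety.kerComponent Φ} (hd : IsPrymTwelvefold C 𝒥 α s Φ sB η)
    [Fact (Irreducible (realPolyQ (bqPoly 1 3)))]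
    (h : complexBetti (AbelianVariety.kerComponent Φ).X 2) (w : complexBetti (AbelianVariety.kerComponent Φ).X (2 * 3))
    (hpol : IsPolarizationClass (AbelianVariety.kerComponent Φ).dim (AbelianVariety.kerComponent Φ).X h)
    (hkae : ∃ s : ℝ, s ≠ 0 ∧
      IsKaehlerClass (AbelianVariety.kerComponent Φ).dim (AbelianVariety.kerComponent Φ).X ((s : ℂ) • h))
    (hros : ∀ x y : complexBetti (AbelianVariety.kerComponent Φ).X 1,
      polarizationPairingOne (AbelianVariety.kerComponent Φ).X h ((AbelianVariety.kerComponent Φ).dim - 1)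
          (pullbackOne (AbelianVariety.kerComponent Φ) η x) y =
        -polarizationPairingOne (AbelianVariety.kerComponent Φ).X h ((AbelianVariety.kerComponent Φ).dim - 1) x
          (pullbackOne (AbelianVariety.kerComponent Φ) η y))
    (hdisc : HasWeilDiscriminantCM (AbelianVariety.kerComponent Φ) η (bqPoly 1 3) 2 3 h
      (splitDiscriminantClassCM (bqPoly 1 3) 3))
    (hlag : IsHyperbolicWeilType (AbelianVariety.kerComponent Φ) η (3 * 2) h)
    (hwW : w ∈ weilClassesField (AbelianVariety.kerComponent Φ) η ((bqPoly 1 3).comp (Polynomial.X ^ 2)) (2 * 3))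
    (hwQ : IsRationalClass w) (hw0 : w ≠ 0) (hseed : HasBlochSeedAt12 (AbelianVariety.kerComponent Φ) h w) :
    PrymBlochSeed13 :=
  ⟨C, 𝒥, α, s, Φ, sB, η, hd, (prym_mem_cell hP hd).isWeilTypeCM, h, w, hpol, hkae, hros, hdisc, hlag, hwW, hwQ, hw0, hseed⟩

end Summit.HodgeConjecture.HodgeConjecture.Cruxes.MarkmanBiquadraticTwelvefolds.PrymSeedPol

end
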